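import Literature.IUT.HodgeArakelov.FlTorsorDihedralToy
import Mathlib.Algebra.Group.Pi.Lemmas

/-!
# The wreath-type group `D_3^{𝔽_l} ⋊ (D_l × ℤ/l)` — coordinates relabelled affinely — and its `l` «cusp» classes
# (group-theoretic substrate of a GENUINE-ACTION witness for [IUTchII] Def 2.3 (v))

S. Mochizuki, *Inter-universal Teichmüller theory II*, kurims manuscript (Dec. 2020), §2 Def 2.3 (v) p. 69: «the
natural action of `Π_⊇/Π_⊆` on `Π_⊆` preserves this `𝔽^±_l`-torsor structure, hence determines a natural outer
isomorphism `Π_⊇/Π_⊆ ≅ 𝔽_l^{⋊±}`» [claim: Mochizuki2012, status: disputed] (IUTchII §2 Def 2.3 (v), kurims p.69)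
(D-0012 claim key; nothing printed is asserted here).

PURE FINITE GROUP THEORY (no claim about print), for the GENUINE-ACTION upgrade of the dihedral `𝔽_l^{⋊±}`-torsor toy
(`FlTorsorDihedralToy.lean` p427711, whose `conjAct` is read off the chart and is provably NOT conjugation —
`FlTorsorConjActKernel.lean`, GAP-LEDGER G-w5d243-1).  Here conjugation DOES act on cusp classes through the affine
group: `B := 𝔽_l → D_3` (one copy of `D_3 ≅ S_3` per label), `D_l` acts on the labels `𝔽_l` through
`dihedralEquivFlPM : D_l ≃* 𝔽_l^{⋊±}` (`labAct`: `x ↦ ±x + a`) and on `B` by relabelling coordinates (`relabel`,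
`act`), `Wr := B ⋊ (D_l × ℤ/l)` (the factor `ℤ/l` acts trivially; it only supplies the index-`l` step of the tower);
the standard cusp at label `e` is `stdCusp e := ⟨s⟩ × 1 ⊆ D_3` in coordinate `e` (`stdK e ⊆ B`, pushed into `Wr`).
Proved: `map_conj_inr_stdCusp` — conjugation by `(1, (q, z))` carries `stdCusp e` to `stdCusp (labAct q e)`;
`map_conj_inl_stdK_eq_iff` — `f ∈ B` normalises `stdK e` iff `f e ∈ N_{D_3}(⟨s⟩) = ⟨s⟩`; `normalizer_stdCusp_inf` —
inside any `Q' = {x | x.right ∈ R'}` with `R' ≤ 1 × ℤ/l`, the normaliser of `stdCusp c` is `{x ∈ Q' | x.left c ∈ ⟨s⟩}`;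
`eq_of_normalizer_conj` — two such normalisers (`c`, `c'`) conjugate by an element of `Q'` force `c = c'`;
`exists_stdCusp_conj_inl` — every `Wr`-conjugate of `stdCusp e` is a `B`-conjugate of `stdCusp (labAct q e)`.
Consumer: `FlTorsorWreathToy.lean` (abc-iut-w5-d243 gen 3).  [claim: Mochizuki2012, status: disputed]
(IUTchII §2 Def 2.3 (v), kurims p.69)
-/

noncomputable section

namespace Literature.IUT.HodgeArakelov

namespace FlTorsorWreathToy

open DihedralGroup DihedralCuspToy FlTorsorToy Literature.IUT.HodgeTheaters

variable (l : ℕ)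

/-! ## 1. Labels `𝔽_l` acted on by `D_l ≅ 𝔽_l^{⋊±}` -/

/-- The affine action of `D_l` on the label set `𝔽_l` through `dihedralEquivFlPM : D_l ≃* 𝔽_l^{⋊±}`
(`r^i : x ↦ x + i`, `s r^i : x ↦ −x − i`). [claim: Mochizuki2012, status: disputed] (IUTchII §2 Def 2.3 (v), kurims p.69) -/
def labAct (q : DihedralGroup l) (x : ZMod l) : ZMod l := dihedralEquivFlPM l q • x

/-- `labAct 1 = id`. [claim: Mochizuki2012, status: disputed] (IUTchII §2 Def 2.3 (v), kurims p.69) -/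
@[simp] theorem labAct_one (x : ZMod l) : labAct l 1 x = x := by simp [labAct]

/-- `labAct (q q') = labAct q ∘ labAct q'`. [claim: Mochizuki2012, status: disputed] (IUTchII §2 Def 2.3 (v), kurims p.69) -/
theorem labAct_mul (q q' : DihedralGroup l) (x : ZMod l) : labAct l (q * q') x = labAct l q (labAct l q' x) := by
  simp [labAct, mul_smul]

/-- `labAct q⁻¹ (labAct q x) = x`. [claim: Mochizuki2012, status: disputed] (IUTchII §2 Def 2.3 (v), kurims p.69) -/
@[simp] theorem labAct_inv_labAct (q : DihedralGroup l) (x : ZMod l) : labAct l q⁻¹ (labAct l q x) = x := by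
  rw [← labAct_mul, inv_mul_cancel, labAct_one]

/-- `labAct q (labAct q⁻¹ x) = x`. [claim: Mochizuki2012, status: disputed] (IUTchII §2 Def 2.3 (v), kurims p.69) -/
@[simp] theorem labAct_labAct_inv (q : DihedralGroup l) (x : ZMod l) : labAct l q (labAct l q⁻¹ x) = x := by
  rw [← labAct_mul, mul_inv_cancel, labAct_one]

/-- `labAct q⁻¹ y = x ↔ y = labAct q x`. [claim: Mochizuki2012, status: disputed] (IUTchII §2 Def 2.3 (v), kurims p.69) -/
theorem labAct_inv_eq_iff (q : DihedralGroup l) (x y : ZMod l) : labAct l q⁻¹ y = x ↔ y = labAct l q x := by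
  constructor
  · rintro rfl; rw [labAct_labAct_inv]
  · rintro rfl; rw [labAct_inv_labAct]

/-- The chart law: `labAct q x = a + ε x` with `(a, ε) = dihedralEquivFlPM q ∈ 𝔽_l ⋊ {±1}`.
[claim: Mochizuki2012, status: disputed] (IUTchII §2 Def 2.3 (v), kurims p.69) -/
theorem labAct_eq (q : DihedralGroup l) (x : ZMod l) :
    labAct l q x = Multiplicative.toAdd (dihedralEquivFlPM l q).left + (((dihedralEquivFlPM l q).right : ℤ) : ZMod l) * x := by
  rw [labAct, FlPM.smul_def, Units.smul_def, zsmul_eq_mul, add_comm]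

/-! ## 2. `B := 𝔽_l → D_3`, relabelling, and the wreath-type group `Wr := B ⋊ (D_l × ℤ/l)` -/

/-- `B := 𝔽_l → D_3` (one copy of `D_3` per label). [claim: Mochizuki2012, status: disputed] (IUTchII §2 Def 2.3 (v), kurims p.69) -/
abbrev B : Type := ZMod l → DihedralGroup 3

/-- `Q := D_l × ℤ/l`. [claim: Mochizuki2012, status: disputed] (IUTchII §2 Def 2.3 (v), kurims p.69) -/
abbrev Qg : Type := DihedralGroup l × Multiplicative (ZMod l)

/-- Relabelling of coordinates by `q ∈ D_l`: `(q · f)(e) := f (q⁻¹ · e)`, a group automorphism of `B`.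
[claim: Mochizuki2012, status: disputed] (IUTchII §2 Def 2.3 (v), kurims p.69) -/
def relabel (q : DihedralGroup l) : B l ≃* B l where
  toFun f e := f (labAct l q⁻¹ e)
  invFun f e := f (labAct l q e)
  left_inv f := by funext e; simp
  right_inv f := by funext e; simp
  map_mul' _ _ := rfl

/-- `relabel` applied. [claim: Mochizuki2012, status: disputed] (IUTchII §2 Def 2.3 (v), kurims p.69) -/
@[simp] theorem relabel_apply (q : DihedralGroup l) (f : B l) (e : ZMod l) : relabel l q f e = f (labAct l q⁻¹ e) := rfl

/-- The action `D_l × ℤ/l → Aut(B)`: `D_l` relabels, `ℤ/l` acts trivially.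
[claim: Mochizuki2012, status: disputed] (IUTchII §2 Def 2.3 (v), kurims p.69) -/
def act : Qg l →* MulAut (B l) where
  toFun q := relabel l q.1
  map_one' := by ext f e; simp
  map_mul' q q' := by ext f e; simp [labAct_mul]

/-- `act` applied. [claim: Mochizuki2012, status: disputed] (IUTchII §2 Def 2.3 (v), kurims p.69) -/
@[simp] theorem act_apply (q : Qg l) (f : B l) (e : ZMod l) : act l q f e = f (labAct l q.1⁻¹ e) := rfl

/-- `Wr := B ⋊ (D_l × ℤ/l)`, the toy's `Π̂^cor_v`. [claim: Mochizuki2012, status: disputed] (IUTchII §2 Def 2.3 (v), kurims p.69) -/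
abbrev Wr : Type := B l ⋊[act l] Qg l

/-- Relabelling a one-coordinate element: `q · (k at e) = k at (labAct q e)`.
[claim: Mochizuki2012, status: disputed] (IUTchII §2 Def 2.3 (v), kurims p.69) -/
theorem act_mulSingle (q : Qg l) (e : ZMod l) (k : DihedralGroup 3) :
    act l q (Pi.mulSingle e k) = Pi.mulSingle (labAct l q.1 e) k := by
  funext e'
  simp only [act_apply, Pi.mulSingle_apply, labAct_inv_eq_iff]

/-- Conjugating a one-coordinate element inside `B`: `f · (k at e) · f⁻¹ = (f e · k · (f e)⁻¹) at e`.
[claim: Mochizuki2012, status: disputed] (IUTchII §2 Def 2.3 (v), kurims p.69) -/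
theorem conj_mulSingle (f : B l) (e : ZMod l) (k : DihedralGroup 3) :
    f * Pi.mulSingle e k * f⁻¹ = Pi.mulSingle e (f e * k * (f e)⁻¹) := by
  funext e'
  simp only [Pi.mul_apply, Pi.inv_apply, Pi.mulSingle_apply]
  split_ifs with h
  · subst h; rfl
  · rw [mul_one, mul_inv_cancel]

/-- Conjugating `inl m` by an arbitrary `x ∈ Wr`: `x · inl m · x⁻¹ = inl (x.left · (x.right · m) · x.left⁻¹)`.
[claim: Mochizuki2012, status: disputed] (IUTchII §2 Def 2.3 (v), kurims p.69) -/
theorem conj_inl (x : Wr l) (m : B l) :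
    x * SemidirectProduct.inl m * x⁻¹ = SemidirectProduct.inl (x.left * act l x.right m * x.left⁻¹) := by
  have h : act l x.right (act l x.right⁻¹ x.left⁻¹) = x.left⁻¹ := by
    rw [← MulAut.mul_apply, ← map_mul, mul_inv_cancel, map_one, MulAut.one_apply]
  refine SemidirectProduct.ext ?_ ?_
  · simp only [SemidirectProduct.mul_left, SemidirectProduct.inv_left, SemidirectProduct.left_inl,
      SemidirectProduct.right_inl, SemidirectProduct.mul_right, mul_one, map_mul, h, map_one, MulAut.one_apply]
  · simp only [SemidirectProduct.mul_right, SemidirectProduct.inv_right, SemidirectProduct.right_inl, mul_one,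
      mul_inv_cancel]

/-- Conjugation by `x = inl x.left · inr x.right` on subgroups, in two steps.
[claim: Mochizuki2012, status: disputed] (IUTchII §2 Def 2.3 (v), kurims p.69) -/
theorem map_conj_eq_map_map (x : Wr l) (H : Subgroup (Wr l)) :
    H.map (MulAut.conj x).toMonoidHom =
      (H.map (MulAut.conj (SemidirectProduct.inr x.right : Wr l)).toMonoidHom).map
        (MulAut.conj (SemidirectProduct.inl x.left : Wr l)).toMonoidHom := by
  rw [Subgroup.map_map]
  congr 1
  refine MonoidHom.ext fun y => ?_
  simp only [MonoidHom.coe_comp, Function.comp_apply, MulEquiv.coe_toMonoidHom, MulAut.conj_apply]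
  conv_lhs => rw [← SemidirectProduct.inl_left_mul_inr_right x]
  rw [mul_inv_rev]
  simp only [mul_assoc]

/-! ## 3. The standard cusps `stdK e = ⟨s⟩ at coordinate e ⊆ B`, `stdCusp e ⊆ Wr` -/

/-- `K₀ := ⟨s⟩ ⊆ D_3` (`= DihedralCuspToy.dsub 3 0 = {1, s}`), self-normalising.
[claim: Mochizuki2012, status: disputed] (IUTchII §2 Def 2.3 (v), kurims p.69) -/
abbrev K0 : Subgroup (DihedralGroup 3) := dsub 3 0

/-- `N_{D_3}(K₀) = K₀`. [claim: Mochizuki2012, status: disputed] (IUTchII §2 Def 2.3 (v), kurims p.69) -/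
theorem normalizer_K0 : Subgroup.normalizer (K0 : Set (DihedralGroup 3)) = K0 :=
  normalizer_dsub_eq 3 (by decide) 0

/-- `r ∉ K₀` and no conjugate of `r` lies in `K₀`. [claim: Mochizuki2012, status: disputed] (IUTchII §2 Def 2.3 (v), kurims p.69) -/
theorem conj_r_one_not_mem_K0 (g : DihedralGroup 3) : g * r 1 * g⁻¹ ∉ K0 := by
  rcases conj_r 3 g 1 with h | h <;> rw [h, r_mem_dsub_iff] <;> rintro ⟨k, hk⟩ <;> rw [zero_mul] at hk <;>
    revert hk <;> decide

/-- `stdK e := K₀` in coordinate `e` (trivial elsewhere). [claim: Mochizuki2012, status: disputed] (IUTchII §2 Def 2.3 (v), kurims p.69) -/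
def stdK (e : ZMod l) : Subgroup (B l) := K0.map (MonoidHom.mulSingle (fun _ : ZMod l => DihedralGroup 3) e)

/-- `stdCusp e := stdK e ⊆ B = B ⋊ 1 ⊆ Wr`. [claim: Mochizuki2012, status: disputed] (IUTchII §2 Def 2.3 (v), kurims p.69) -/
def stdCusp (e : ZMod l) : Subgroup (Wr l) := (stdK l e).map SemidirectProduct.inl

/-- Relabelling the standard cusp: `act q (stdK e) = stdK (labAct q e)`.
[claim: Mochizuki2012, status: disputed] (IUTchII §2 Def 2.3 (v), kurims p.69) -/
theorem map_act_stdK (q : Qg l) (e : ZMod l) :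
    (stdK l e).map (act l q).toMonoidHom = stdK l (labAct l q.1 e) := by
  rw [stdK, stdK, Subgroup.map_map]
  congr 1
  refine MonoidHom.ext fun k => ?_
  simp only [MonoidHom.coe_comp, Function.comp_apply, MonoidHom.mulSingle_apply, MulEquiv.coe_toMonoidHom]
  exact act_mulSingle l q e k

/-- **Conjugation by `(1, q)` relabels the standard cusps affinely**: `(stdCusp e)^{inr q} = stdCusp (labAct q e)`.
[claim: Mochizuki2012, status: disputed] (IUTchII §2 Def 2.3 (v), kurims p.69) -/
theorem map_conj_inr_stdCusp (q : Qg l) (e : ZMod l) :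
    (stdCusp l e).map (MulAut.conj (SemidirectProduct.inr q : Wr l)).toMonoidHom = stdCusp l (labAct l q.1 e) := by
  rw [stdCusp, stdCusp, Subgroup.map_map, ← map_act_stdK l q e, Subgroup.map_map]
  congr 1
  refine MonoidHom.ext fun n => ?_
  simp only [MonoidHom.coe_comp, Function.comp_apply, MulEquiv.coe_toMonoidHom, MulAut.conj_apply]
  rw [SemidirectProduct.inl_aut, map_inv]

/-- Conjugation by `inl f` on the standard cusp: `(stdCusp e)^{inl f} = inl((stdK e)^f)`.
[claim: Mochizuki2012, status: disputed] (IUTchII §2 Def 2.3 (v), kurims p.69) -/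
theorem map_conj_inl_eq (f : B l) (H : Subgroup (B l)) :
    (H.map SemidirectProduct.inl : Subgroup (Wr l)).map (MulAut.conj (SemidirectProduct.inl f : Wr l)).toMonoidHom =
      (H.map (MulAut.conj f).toMonoidHom).map SemidirectProduct.inl := by
  rw [Subgroup.map_map, Subgroup.map_map]
  congr 1
  refine MonoidHom.ext fun n => ?_
  simp only [MonoidHom.coe_comp, Function.comp_apply, MulEquiv.coe_toMonoidHom, MulAut.conj_apply, map_mul,
    map_inv]

/-- Conjugating `stdK e` inside `B`: `(stdK e)^f = (K₀^{f e}) at e`.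
[claim: Mochizuki2012, status: disputed] (IUTchII §2 Def 2.3 (v), kurims p.69) -/
theorem map_conj_stdK (f : B l) (e : ZMod l) :
    (stdK l e).map (MulAut.conj f).toMonoidHom =
      (K0.map (MulAut.conj (f e)).toMonoidHom).map (MonoidHom.mulSingle (fun _ : ZMod l => DihedralGroup 3) e) := by
  rw [stdK, Subgroup.map_map, Subgroup.map_map]
  congr 1
  refine MonoidHom.ext fun k => ?_
  simp only [MonoidHom.coe_comp, Function.comp_apply, MulEquiv.coe_toMonoidHom, MulAut.conj_apply,
    MonoidHom.mulSingle_apply]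
  exact conj_mulSingle l f e k

/-- **`f ∈ B` normalises `stdK e` iff `f e ∈ K₀`** (`K₀` self-normalising in `D_3`).
[claim: Mochizuki2012, status: disputed] (IUTchII §2 Def 2.3 (v), kurims p.69) -/
theorem map_conj_stdK_eq_iff (f : B l) (e : ZMod l) : (stdK l e).map (MulAut.conj f).toMonoidHom = stdK l e ↔ f e ∈ K0 := by
  rw [map_conj_stdK, stdK, (Subgroup.map_injective (f := MonoidHom.mulSingle (fun _ : ZMod l => DihedralGroup 3) e)
    (Pi.mulSingle_injective (M := fun _ : ZMod l => DihedralGroup 3) e)).eq_iff, MulEquiv.toMonoidHom_eq_coe,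
    ← Subgroup.mem_normalizer_iff_map_conj_eq, normalizer_K0]

/-- Membership in `stdCusp e`: `x.right = 1` and `x.left ∈ stdK e`.
[claim: Mochizuki2012, status: disputed] (IUTchII §2 Def 2.3 (v), kurims p.69) -/
theorem mem_stdCusp_iff (e : ZMod l) (x : Wr l) : x ∈ stdCusp l e ↔ x.right = 1 ∧ x.left ∈ stdK l e := by
  constructor
  · rintro ⟨n, hn, rfl⟩
    exact ⟨rfl, hn⟩
  · rintro ⟨h1, h2⟩
    refine ⟨x.left, h2, ?_⟩
    rw [← SemidirectProduct.inl_left_mul_inr_right x, h1, map_one, mul_one, SemidirectProduct.left_inl]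

/-- Membership in `stdK e`: `f e ∈ K₀` and `f` trivial off `e`.
[claim: Mochizuki2012, status: disputed] (IUTchII §2 Def 2.3 (v), kurims p.69) -/
theorem mem_stdK_iff (e : ZMod l) (f : B l) : f ∈ stdK l e ↔ f e ∈ K0 ∧ ∀ e', e' ≠ e → f e' = 1 := by
  constructor
  · rintro ⟨k, hk, rfl⟩
    refine ⟨by simpa using hk, fun e' he' => ?_⟩
    simp [MonoidHom.mulSingle_apply, he']
  · rintro ⟨h1, h2⟩
    refine ⟨f e, h1, funext fun e' => ?_⟩
    by_cases h : e' = e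
    · subst h; simp
    · rw [MonoidHom.mulSingle_apply, Pi.mulSingle_apply, if_neg h, h2 e' h]

/-! ## 4. Normalisers of the standard cusps inside `Q' = {x | x.right ∈ R'}`, `R' ≤ 1 × ℤ/l` -/

section Normalizers

variable {R' : Subgroup (Qg l)} (hR' : ∀ q ∈ R', q.1 = 1)
include hR'

/-- For `x` with `x.right ∈ R'` (so `x.right` relabels trivially): `(stdCusp c)^x = inl((stdK c)^{x.left})`.
[claim: Mochizuki2012, status: disputed] (IUTchII §2 Def 2.3 (v), kurims p.69) -/
theorem map_conj_stdCusp_of_right_mem {x : Wr l} (hx : x.right ∈ R') (c : ZMod l) :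
    (stdCusp l c).map (MulAut.conj x).toMonoidHom = ((stdK l c).map (MulAut.conj x.left).toMonoidHom).map SemidirectProduct.inl := by
  have hx1 : labAct l x.right.1 c = c := by rw [hR' _ hx, labAct_one]
  rw [map_conj_eq_map_map, map_conj_inr_stdCusp, hx1, stdCusp, map_conj_inl_eq]

/-- **`x ∈ Q'` normalises `stdCusp c` iff `x.left c ∈ K₀`.** [claim: Mochizuki2012, status: disputed] (IUTchII §2 Def 2.3 (v), kurims p.69) -/
theorem mem_normalizer_stdCusp_iff {x : Wr l} (hx : x.right ∈ R') (c : ZMod l) :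
    x ∈ Subgroup.normalizer (stdCusp l c : Set (Wr l)) ↔ x.left c ∈ K0 := by
  rw [Subgroup.mem_normalizer_iff_map_conj_eq, ← map_conj_stdK_eq_iff, ← MulEquiv.toMonoidHom_eq_coe,
    map_conj_stdCusp_of_right_mem l hR' hx, stdCusp]
  exact (Subgroup.map_injective (SemidirectProduct.inl_injective (φ := act l))).eq_iff

/-- **Separation**: if the `Q'`-normalisers of `stdCusp c` and `stdCusp c'` are conjugate by some `n ∈ Q'`, then
`c = c'` (test element: `r` at coordinate `c'`, conjugated by `n`). [claim: Mochizuki2012, status: disputed] (IUTchII §2 Def 2.3 (v), kurims p.69) -/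
theorem eq_of_normalizer_conj {Q' : Subgroup (Wr l)} (hQ' : ∀ x, x ∈ Q' ↔ x.right ∈ R') {n : Wr l} (hn : n ∈ Q')
    {c c' : ZMod l}
    (h : Subgroup.normalizer (stdCusp l c' : Set (Wr l)) ⊓ Q' =
      (Subgroup.normalizer (stdCusp l c : Set (Wr l)) ⊓ Q').map (MulAut.conj n).toMonoidHom) : c = c' := by
  by_contra hcc
  -- the test element `y := inl (r at c')` lies in `N(stdCusp c) ⊓ Q'` (its `c`-coordinate is `1 ∈ K₀`)
  set y : Wr l := SemidirectProduct.inl (Pi.mulSingle c' (r 1 : DihedralGroup 3)) with hy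
  have hy1 : y.right ∈ R' := by rw [hy, SemidirectProduct.right_inl]; exact one_mem R'
  have hyN : y ∈ Subgroup.normalizer (stdCusp l c : Set (Wr l)) ⊓ Q' := by
    refine ⟨(mem_normalizer_stdCusp_iff l hR' hy1 c).mpr ?_, (hQ' y).mpr hy1⟩
    rw [hy, SemidirectProduct.left_inl, Pi.mulSingle_apply, if_neg hcc]
    exact one_mem K0
  -- hence `n y n⁻¹ ∈ N(stdCusp c') ⊓ Q'`, i.e. its `c'`-coordinate — a conjugate of `r` — lies in `K₀`
  have hconj : n * y * n⁻¹ ∈ Subgroup.normalizer (stdCusp l c' : Set (Wr l)) ⊓ Q' := by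
    rw [h]; exact ⟨y, hyN, rfl⟩
  have hq : n.right.1 = 1 := hR' _ ((hQ' n).mp hn)
  have h2 := (mem_normalizer_stdCusp_iff l hR' ((hQ' _).mp hconj.2) c').mp hconj.1
  have hleft : (n * y * n⁻¹).left c' = n.left c' * r 1 * (n.left c')⁻¹ := by
    rw [hy, conj_inl, SemidirectProduct.left_inl, act_mulSingle, hq, labAct_one, conj_mulSingle,
      Pi.mulSingle_eq_same]
  rw [hleft] at h2
  exact conj_r_one_not_mem_K0 _ h2

end Normalizers

/-! ## 5. Normal form of an arbitrary conjugate of a standard cusp -/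

/-- Every `Wr`-conjugate of `stdCusp e` is a `B`-conjugate (conjugation by some `inl h`) of `stdCusp (labAct q e)`,
`q` the `D_l`-component of the conjugating element. [claim: Mochizuki2012, status: disputed] (IUTchII §2 Def 2.3 (v), kurims p.69) -/
theorem exists_stdCusp_conj_inl (e : ZMod l) (g : Wr l) :
    ∃ h : B l, (stdCusp l e).map (MulAut.conj g).toMonoidHom =
      (stdCusp l (labAct l g.right.1 e)).map (MulAut.conj (SemidirectProduct.inl h : Wr l)).toMonoidHom := by
  refine ⟨g.left, ?_⟩
  rw [map_conj_eq_map_map, map_conj_inr_stdCusp]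

/-! ## 6. Conjugation bookkeeping on subgroups of `Wr` -/

/-- Composing conjugations on subgroups. [claim: Mochizuki2012, status: disputed] (IUTchII §2 Def 2.3 (iii), kurims p.68) -/
theorem map_conj_map_conj (x y : Wr l) (H : Subgroup (Wr l)) :
    (H.map (MulAut.conj y).toMonoidHom).map (MulAut.conj x).toMonoidHom = H.map (MulAut.conj (x * y)).toMonoidHom := by
  rw [Subgroup.map_map, map_mul]; rfl

/-- Conjugation by `1` on subgroups. [claim: Mochizuki2012, status: disputed] (IUTchII §2 Def 2.3 (iii), kurims p.68) -/
theorem map_conj_one (H : Subgroup (Wr l)) : H.map (MulAut.conj (1 : Wr l)).toMonoidHom = H := by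
  rw [map_one]; ext x; simp

section NormalizerMap

variable {Qsup : Subgroup (Wr l)}

/-- The normaliser bookkeeping of `labelRel` commutes with conjugation by `n ∈ Π_⊇`: `N_{Π_⊇}(X^n) = N_{Π_⊇}(X)^n`
(both pushed into `Π̂^cor_v`). [claim: Mochizuki2012, status: disputed] (IUTchII §2 Def 2.3 (iii), kurims p.68) -/
theorem normalizerMap_conj {X : Subgroup (Wr l)} (hX : X ≤ Qsup) {n : Wr l} (hn : n ∈ Qsup) :
    (Subgroup.normalizer (((X.map (MulAut.conj n).toMonoidHom).subgroupOf Qsup : Subgroup Qsup) : Set Qsup)).map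
        Qsup.subtype =
      ((Subgroup.normalizer ((X.subgroupOf Qsup : Subgroup Qsup) : Set Qsup)).map Qsup.subtype).map
        (MulAut.conj n).toMonoidHom := by
  have hQn : Qsup.map (MulAut.conj n).toMonoidHom = Qsup := by
    rw [MulEquiv.toMonoidHom_eq_coe]
    exact Subgroup.mem_normalizer_iff_map_conj_eq.mp (Subgroup.le_normalizer hn)
  have hXn : X.map (MulAut.conj n).toMonoidHom ≤ Qsup := (Subgroup.map_mono hX).trans_eq hQn
  rw [← Subgroup.subgroupOf_normalizer_eq hXn, ← Subgroup.subgroupOf_normalizer_eq hX,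
    Subgroup.subgroupOf_map_subtype, Subgroup.subgroupOf_map_subtype,
    Subgroup.map_inf _ _ _ (MulAut.conj n).injective, hQn, ← Subgroup.map_equiv_normalizer_eq]

end NormalizerMap

/-! ## 7. The [IUTchII] §1–§2 setting of the wreath toy: `Π_v := B = 𝔽_l → D_3` -/

section Setting

variable (p : ℕ) (hl : l.Prime) (hl2 : l ≠ 2) (hp : p.Prime) (hp2 : p ≠ 2) (hpl : p ≠ l)

/-- The toy `ThetaSetting`: `Π_v := B` (discrete), `G_v := 1`, `k := ℂ`, trivial model environment.
[claim: Mochizuki2012, status: disputed] (IUTchII §1, kurims p.20) -/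
@[reducible] def wSetting : ThetaSetting.{0} where
  N := 1
  l := l
  l_prime := hl
  l_odd := hl2
  p := p
  p_prime := hp
  p_odd := hp2
  p_ne_l := hpl
  k := ℂ
  hasPrimitiveRoot := ⟨Complex.exp (2 * Real.pi * Complex.I / (4 * l : ℕ)),
    Complex.isPrimitiveRoot_exp (4 * l) (by have := hl.pos; omega)⟩
  PiX := TopGroup.of (B l)
  Gk := TopGroup.of (Multiplicative (ZMod 1))
  aug := 1
  aug_continuous := continuous_const
  aug_surjective := fun _ => ⟨1, Subsingleton.elim _ _⟩
  modelPi := TopGroup.of (Multiplicative (ZMod 1))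
  modelD := ⊤
  modelD_inn := le_top
  modelD_continuous := fun φ _ => ⟨continuous_of_discreteTopology, continuous_of_discreteTopology⟩
  modelTheta := ∅

/-- The toy `BadPlaceSetting`: `Π^tp_{X_v} := Π_v = B` with the identity inclusion, reference coverings `⊤`.
[claim: Mochizuki2012, status: disputed] (IUTchII §2 Prop 2.1, kurims pp.64-65) -/
@[reducible] def wBadPlaceSetting : BadPlaceSetting.{0} where
  toThetaSetting := wSetting l p hl hl2 hp hp2 hpl
  PiXplain := TopGroup.of (B l)
  inclPlain := MonoidHom.id _
  inclPlain_isOpenEmbedding := Topology.IsOpenEmbedding.id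
  refY := ⊤
  refYdd := ⊤
  refYdd_le := le_rfl
  isOpen_refY := isOpen_univ
  isOpen_refYdd := isOpen_univ

/-- The toy `TemperedCoverings` over `P := Π_v`: the reference diagram itself.
[claim: Mochizuki2012, status: disputed] (IUTchII §2 Prop 2.1, kurims pp.64-65) -/
@[reducible] def wCoverings : TemperedCoverings (wBadPlaceSetting l p hl hl2 hp hp2 hpl)
    (wBadPlaceSetting l p hl hl2 hp hp2 hpl).PiX where
  isoRef := ⟨ContinuousMulEquiv.refl _⟩
  Xplain := TopGroup.of (B l)
  incl := MonoidHom.id _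
  incl_isOpenEmbedding := Topology.IsOpenEmbedding.id
  Y := ⊤
  Ydd := ⊤
  Ydd_le := le_rfl
  isOpen_Y := isOpen_univ
  isOpen_Ydd := isOpen_univ
  corresponds := ⟨ContinuousMulEquiv.refl _, ContinuousMulEquiv.refl _, fun _ => rfl,
    Subgroup.map_id ⊤, Subgroup.map_id ⊤⟩

end Setting

end FlTorsorWreathToy

end Literature.IUT.HodgeArakelov

end
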